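import Literature.NumberTheory.EllipticCurves.CyclotomicZpExtensionLayerGeneratorProofs
import Literature.NumberTheory.EllipticCurves.CyclotomicZpExtensionLayerTorsionProofs
import HarnessLib

/-!
# The cyclotomic `ℤ₂`-extension of `ℚ`: the image of the layer group `Gal(ℚ̄/ℚ_n)` under the
# mod-`2^{n+2}` cyclotomic character is `{±1}`, and the image of a topological generator generates
# `(ℤ/2^{n+2})ˣ/{±1}` (the `p = 2` twin of `CyclotomicZpExtensionLayerTorsionProofs`; proofs only)

Topic `NumberTheory/EllipticCurves` (next to `CyclotomicZpExtension.lean`,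
`CyclotomicZpExtensionLayerTwoProofs.lean`, `CyclotomicZpExtensionLayerTorsionProofs.lean`). Cell `bsd-2adic`,
seat `bsd-2adic-addL2x` (GEN 20; crux stmt-BirchSwinnertonDyer-19098 `AdditiveRankZeroAtTwo`, child C4″
stmt-BirchSwinnertonDyer-22618): the `-- TODO(general form): p = 2` left in
`CyclotomicZpExtensionLayerTorsionProofs.lean`. THEOREMS ONLY (no definition, no named fact, no instance).

`CyclotomicZpExtensionLayerTwoProofs` proved `Gal(ℚ̄/ℚ(μ_{2^{n+2}})) ≤ Gal(ℚ̄/ℚ_n)` (`ℚ_n = ℚ(ζ_{2^{n+2}})⁺`).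
Here the complementary half of Washington's «`ℚ_∞ ⊂ ℚ(μ_{2^∞})` is the fixed field of `{±1} = (ℤ/4)ˣ`»
[§13.1]: for `σ ∈ Gal(ℚ̄/ℚ_n)` the mod-`2^{n+2}` cyclotomic character satisfies `χ^{(2^{n+2})}(σ) = ±1`, so that
every EVEN Dirichlet character mod `2^{n+2}` kills `χ^{(2^{n+2})}(Gal(ℚ̄/ℚ_n))` — the hypothesis `hχ` of
`Kato2004.charSum_eq_zero_of_coresLe_eq_zero` (`Kato2004/ZetaBodyLayerValuesProofs.lean`) at `p = 2`; and for a
topological generator `γ` of a cyclotomic `κ` (`κ γ = 1`), every unit `b ∈ (ℤ/2^{n+2})ˣ` is `± χ^{(2^{n+2})}(γ)^t`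
(`Gal(ℚ_n/ℚ) = (ℤ/2^{n+2})ˣ/{±1}` is cyclic, generated by the image of `γ`).

## Statements

* `CyclotomicZp.toZModPow_eq_one_or_eq_neg_one_of_pow_dvd_ell_two` — for a unit `u` of `ℤ₂` with `2^n ∣ ℓ(u)`
  (normalised logarithm `ℓ` of `CyclotomicZpExtension.lean`, `γ_cyc = 5`, `5^{2ℓ(u)} = u²`):
  `u ≡ ±1 (mod 2^{n+2})` in `ℤ/2^{n+2}` — the tree's `pow_dvd_sub_one_or_pow_dvd_add_one_of_pow_dvd_ell`
  (`CyclotomicZpExtensionLayerGeneratorProofs`, from `‖5^y − 1‖ = ‖y‖·‖4‖`) read through `ker (ℤ₂ → ℤ/2^{n+2})`.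
* `CyclotomicZp.modNCyclotomicCharacter_eq_one_or_eq_neg_one_of_mem_layerSubgroup_zpExtension_two` and, for
  EVERY cyclotomic `κ : ZpExtension ℚ 2` (a unit twist of `κ_cyc`, same layers),
  `ZpExtension.IsCyclotomic.modNCyclotomicCharacter_eq_one_or_eq_neg_one_of_mem_layerSubgroup_two`:
  `σ ∈ κ.layerSubgroup n ⇒ χ^{(M)}(σ) = ±1` for `M = 2^{n+2}`;
  `ZpExtension.IsCyclotomic.dirichletCharacter_apply_eq_one_of_mem_layerSubgroup_two`: an EVEN Dirichlet
  character mod `M` kills `χ^{(M)}(σ)` for `σ ∈ κ.layerSubgroup n`.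
* `ZpExtension.IsCyclotomic.exists_eq_pow_or_eq_neg_pow_of_isTopGenerator_two` — for `γ` a topological
  generator of a cyclotomic `κ` and `u := χ^{(M)}(γ)`, `M = 2^{n+2}`: every `b ∈ (ℤ/M)ˣ` is `u^t` or `−u^t`
  for some `t ∈ ℕ` (surjectivity of the cyclotomic character `Gal(ℚ̄/ℚ) → (ℤ/M)ˣ`, `κ(σγ^{−t}) ∈ 2^nℤ₂` for
  `t ≡ κ(σ) (mod 2^n)`, and the previous item).

References: L. C. Washington, *Introduction to Cyclotomic Fields*, 2nd ed. (1997), §13.1 [Washington1997];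
J.-P. Serre, *A Course in Arithmetic*, Ch. II §3.2 Prop. 8 (`ℤ₂ˣ = {±1} × (1 + 4ℤ₂)`, `1 + 4ℤ₂ = 5^{ℤ₂}`)
[Serre1973]; tree: `CyclotomicZpExtension.lean` (`ell`, `zpExtension`, `exists_cyclotomicCharacter_toZModPow_eq`),
`CyclotomicZpExtensionLayerGeneratorProofs.lean` (`pow_dvd_sub_one_or_pow_dvd_add_one_of_pow_dvd_ell`),
`CyclotomicZpExtensionLayerTorsionProofs.lean` (`modNCyclotomicCharacter_eq_toZModPow`),
`ZpExtensionUnitTwistProofs.lean` (`IsCyclotomic.exists_eq_unitTwist_holds`).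
-/

set_option autoImplicit false

noncomputable section

open scoped NumberField
open Field
open Literature.NumberTheory.GaloisRepresentations
open Literature.NumberTheory.EllipticCurves Literature.NumberTheory.EllipticCurves.PadicOneUnits

namespace Literature.NumberTheory.EllipticCurves.CyclotomicZp

/-- **`u ≡ ±1 (mod 2^{n+2})` when `2^n ∣ ℓ(u)`** (`p = 2`), in `ℤ/2^{n+2}`: the tree's
`pow_dvd_sub_one_or_pow_dvd_add_one_of_pow_dvd_ell` (`2^{n+2} ∣ u − 1` or `2^{n+2} ∣ u + 1`, from
`‖5^y − 1‖ = ‖y‖·‖4‖`) read through `ker (ℤ₂ → ℤ/2^{n+2}) = 2^{n+2}ℤ₂`. (Washington §13.1: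
`Gal(ℚ(ζ_{2^{n+2}})/ℚ_n) = {±1}`.) [cite: Serre1973, Ch. II §3.2 Prop. 8] [cite: Washington1997, §13.1] -/
theorem toZModPow_eq_one_or_eq_neg_one_of_pow_dvd_ell_two (u : ℤ_[2]ˣ) (n : ℕ)
    (h : (2 : ℤ_[2]) ^ n ∣ ell 2 u) :
    PadicInt.toZModPow (n + 2) (u : ℤ_[2]) = 1 ∨ PadicInt.toZModPow (n + 2) (u : ℤ_[2]) = -1 := by
  -- `2^{n+2} ∣ x` means `x ∈ ker (toZModPow (n+2))`
  have hker : ∀ x : ℤ_[2], (2 : ℤ_[2]) ^ (n + 2) ∣ x → PadicInt.toZModPow (n + 2) x = 0 := by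
    intro x hx
    have hx' : x ∈ Ideal.span {((2 : ℕ) : ℤ_[2]) ^ (n + 2)} := by
      rw [Ideal.mem_span_singleton, Nat.cast_ofNat]; exact hx
    rw [← PadicInt.ker_toZModPow, RingHom.mem_ker] at hx'
    exact hx'
  rcases pow_dvd_sub_one_or_pow_dvd_add_one_of_pow_dvd_ell u n h with hdvd | hdvd
  · left
    have h5 := hker _ hdvd
    rwa [map_sub, map_one, sub_eq_zero] at h5
  · right
    have h5 := hker _ hdvd
    rwa [map_add, map_one, add_eq_zero_iff_eq_neg] at h5

/-- **`σ ∈ Gal(ℚ̄/ℚ_n)` ⇒ `χ^{(2^{n+2})}(σ) = ±1`** for the normalised cyclotomic `ℤ₂`-extension `κ_cyc = ℓ ∘ χ₂`: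
`σ ∈ κ_cyc⁻¹(2^n ℤ₂)` means `2^n ∣ ℓ(χ₂ σ)`, so `χ₂(σ) ≡ ±1 (mod 2^{n+2})`, and the mod-`2^{n+2}` character is the
reduction of `χ₂` (`modNCyclotomicCharacter_eq_toZModPow`). (Washington §13.1: `Gal(ℚ(ζ_{2^{n+2}})/ℚ_n) = {±1}`.)
[cite: Washington1997, §13.1] -/
theorem modNCyclotomicCharacter_eq_one_or_eq_neg_one_of_mem_layerSubgroup_zpExtension_two (n : ℕ)
    [NeZero (2 ^ (n + 2))] {σ : absoluteGaloisGroup ℚ} (hσ : σ ∈ (zpExtension 2).layerSubgroup n) :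
    modNCyclotomicCharacter ℚ (2 ^ (n + 2)) σ = 1 ∨ modNCyclotomicCharacter ℚ (2 ^ (n + 2)) σ = -1 := by
  rw [ZpExtension.mem_layerSubgroup, zpExtension_apply, toAdd_ofAdd] at hσ
  have h := toZModPow_eq_one_or_eq_neg_one_of_pow_dvd_ell_two (GaloisRep.cyclotomicCharacter ℚ 2 σ) n hσ
  have key : ((modNCyclotomicCharacter ℚ (2 ^ (n + 2)) σ : (ZMod (2 ^ (n + 2)))ˣ) : ZMod (2 ^ (n + 2))) =
      (GaloisRep.cyclotomicCharacter ℚ 2 σ).val.toZModPow (n + 2) :=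
    modNCyclotomicCharacter_eq_toZModPow 2 (n + 2) σ
  rcases h with h | h
  · left
    ext
    rw [key, Units.val_one]
    exact h
  · right
    ext
    rw [key, Units.val_neg, Units.val_one]
    exact h

end Literature.NumberTheory.EllipticCurves.CyclotomicZp

namespace Literature.NumberTheory.EllipticCurves.ZpExtension

/-- **`σ ∈ Gal(ℚ̄/ℚ_n)` ⇒ `χ^{(M)}(σ) = ±1`, `M = 2^{n+2}`, for EVERY cyclotomic `ℤ₂`-extension `κ` of `ℚ`** (`κ` is a
unit twist of `κ_cyc`, with the same layers). [cite: Washington1997, §13.1] -/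
theorem IsCyclotomic.modNCyclotomicCharacter_eq_one_or_eq_neg_one_of_mem_layerSubgroup_two
    {κ : ZpExtension ℚ 2} (hκ : κ.IsCyclotomic) (n : ℕ) {M : ℕ} [NeZero M] (hM : M = 2 ^ (n + 2))
    {σ : absoluteGaloisGroup ℚ} (hσ : σ ∈ κ.layerSubgroup n) :
    modNCyclotomicCharacter ℚ M σ = 1 ∨ modNCyclotomicCharacter ℚ M σ = -1 := by
  subst hM
  obtain ⟨u, rfl⟩ := IsCyclotomic.exists_eq_unitTwist_holds
    (CyclotomicZp.isCyclotomic_zpExtension 2) hκ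
  rw [layerSubgroup_unitTwist] at hσ
  exact CyclotomicZp.modNCyclotomicCharacter_eq_one_or_eq_neg_one_of_mem_layerSubgroup_zpExtension_two n hσ

/-- **An EVEN Dirichlet character mod `M = 2^{n+2}` kills the image of `Gal(ℚ̄/ℚ_n)`** under the mod-`M`
cyclotomic character (every cyclotomic `κ`, `p = 2`) — the hypothesis of
`Kato2004.charSum_eq_zero_of_coresLe_eq_zero` at `p = 2` (the even characters mod `2^{n+2}` are the characters
of `Gal(ℚ_n/ℚ) = (ℤ/2^{n+2})ˣ/{±1}`). [cite: Washington1997, §13.1] -/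
theorem IsCyclotomic.dirichletCharacter_apply_eq_one_of_mem_layerSubgroup_two {κ : ZpExtension ℚ 2}
    (hκ : κ.IsCyclotomic) (n : ℕ) {M : ℕ} [NeZero M] (hM : M = 2 ^ (n + 2))
    {R : Type*} [CommMonoidWithZero R] (χ : DirichletCharacter R M) (hχ : χ (-1) = 1)
    {σ : absoluteGaloisGroup ℚ} (hσ : σ ∈ κ.layerSubgroup n) :
    χ ((modNCyclotomicCharacter ℚ M σ : (ZMod M)ˣ) : ZMod M) = 1 := by
  rcases hκ.modNCyclotomicCharacter_eq_one_or_eq_neg_one_of_mem_layerSubgroup_two n hM hσ with h | h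
  · rw [h, Units.val_one, map_one]
  · rw [h, Units.val_neg, Units.val_one, hχ]

/-- **The image of a topological generator generates `Gal(ℚ_n/ℚ) = (ℤ/2^{n+2})ˣ/{±1}`.** Let `κ` be a cyclotomic
`ℤ₂`-extension of `ℚ` with topological generator `γ` (`κ γ = 1`), `M = 2^{n+2}` and `u := χ^{(M)}(γ)`. Then every
`b ∈ (ℤ/M)ˣ` is `u^t` or `−u^t` for some `t ∈ ℕ`: pick `σ` with `χ^{(M)}(σ) = b` (the cyclotomic character is onto,
`GaloisRep.exists_cyclotomicCharacter_toZModPow_eq`) and `t ≡ κ(σ) (mod 2^n)`; then `κ(σγ^{−t}) = κ(σ) − t ∈ 2^nℤ₂`,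
i.e. `σγ^{−t} ∈ Gal(ℚ̄/ℚ_n)`, so `b·u^{−t} = χ^{(M)}(σγ^{−t}) = ±1`. [cite: Washington1997, §13.1] -/
theorem IsCyclotomic.exists_eq_pow_or_eq_neg_pow_of_isTopGenerator_two {κ : ZpExtension ℚ 2}
    (hκ : κ.IsCyclotomic) {γ : absoluteGaloisGroup ℚ} (hγ : κ.IsTopGenerator γ) (n : ℕ) {M : ℕ}
    [NeZero M] (hM : M = 2 ^ (n + 2)) (b : (ZMod M)ˣ) :
    ∃ t : ℕ, b = modNCyclotomicCharacter ℚ M γ ^ t ∨ b = -(modNCyclotomicCharacter ℚ M γ ^ t) := by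
  subst hM
  -- `σ` with `χ^{(M)}(σ) = b`
  obtain ⟨σ, hσ⟩ := GaloisRep.exists_cyclotomicCharacter_toZModPow_eq 2 (n + 2) (b : ZMod (2 ^ (n + 2))).val
    (ZMod.val_coe_unit_coprime b)
  have hσb : modNCyclotomicCharacter ℚ (2 ^ (n + 2)) σ = b := by
    ext
    rw [CyclotomicZp.modNCyclotomicCharacter_eq_toZModPow 2 (n + 2) σ, hσ, ZMod.natCast_zmod_val]
  -- `t ≡ κ σ (mod 2^n)`
  set s : ℤ_[2] := (κ σ).toAdd with hs
  set t : ℕ := (PadicInt.toZModPow n s).val with ht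
  have hst : ((2 : ℕ) : ℤ_[2]) ^ n ∣ s - t := by
    rw [← Ideal.mem_span_singleton, ← PadicInt.ker_toZModPow, RingHom.mem_ker, map_sub, map_natCast, ht,
      ZMod.natCast_zmod_val, sub_self]
  -- `σ γ^{-t} ∈ Gal(ℚ̄/ℚ_n)`
  have hmem : σ * (γ ^ t)⁻¹ ∈ κ.layerSubgroup n := by
    rw [mem_layerSubgroup, map_mul, map_inv, map_pow, hγ, ← ofAdd_nsmul, nsmul_eq_mul, mul_one]
    change ((2 : ℕ) : ℤ_[2]) ^ n ∣
      Multiplicative.toAdd (Multiplicative.ofAdd s * (Multiplicative.ofAdd (t : ℤ_[2]))⁻¹)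
    rw [← ofAdd_neg, ← ofAdd_add, toAdd_ofAdd, ← sub_eq_add_neg]
    exact hst
  have h := hκ.modNCyclotomicCharacter_eq_one_or_eq_neg_one_of_mem_layerSubgroup_two n rfl hmem
  rw [map_mul, map_inv, map_pow, hσb] at h
  refine ⟨t, ?_⟩
  rcases h with h | h
  · left
    rwa [mul_inv_eq_one] at h
  · right
    rw [mul_inv_eq_iff_eq_mul] at h
    rw [h, neg_one_mul]

end Literature.NumberTheory.EllipticCurves.ZpExtension

end
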